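import Summits.Ventures.Crystal3D.Theorems.StickyWulffConstantNoReconstructionGainOffRegistry
import HarnessLib

/-!
# The atom at every normal for films with antipodally supported contact shells

HONEST FRAMING. Part of the venture `Summits/Ventures/Crystal3D` (cell `crystal3d-full`), helper
`--supports` the crux `NoReconstructionGain` (stmt-Ventures-19144, route
`route-Ventures-StickyWulffConstant`), line `adhesion`.  The registry lemma of the R26 line
(`registry_noGainPotential`, `…Registry`: a LATTICE film ball always satisfies the no-gain
inequality (T2) for a convex gauge) uses the lattice `Λ₀` only through one geometric feature: the
contacts of a lattice ball sit on the SIX bond lines through its centre, so that a substrate or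
gauge-below partner `q + w` reserves the antipodal slot `q − w` (convexity makes it gauge-above or
empty).  This file frees the argument from the lattice:

* `antipodal_noGainPotential` — per ball: if the partners of a film ball `q` in `X` lie on at most
  six lines through `q` (`x = q ± w`, `w ∈ W`, `#W ≤ 6`), substrate partners are gauge-below and the
  gauge `f` is midpoint-convex at `q`, then (T2) holds at `q` for any potential ordered like `f` near
  `q`;
* `antipodalFilm_adhesion` — **the rung** (every normal `ν`, `R = 1`, `C = 0`; registered by name):
  the atom `#cross(P, X \ P) ≤ contactDeficiency (X \ P)` for every finite unit packing `X ⊇ P`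
  around the `ν`-slab sample `P` in which every film ball EITHER has at most six contacts OR has all
  its contacts on at most six lines through its centre, and film balls touching the substrate lie
  outside the slab sample region (automatic for lattice balls).  Proof: rank the film by the convex
  slab gauge of `…OffRegistry` and telescope (`cross_le_of_potential`, `E = ∅`).

The class is dense and orientation-free ball by ball: arbitrarily placed and arbitrarily ROTATED
fcc-like (sub-cuboctahedral) shells, a different frame at every ball, lattice films and cosets,
any coordination; it excludes exactly the non-centrosymmetric high-coordination shells (hcp-like,
icosahedral) where, by the WK no-go, every gauge-type certificate must fail.

WHAT THIS IS NOT: the atom for films with anticuboctahedral / icosahedral 12-shells; rung F-C1 not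
moved.
-/

noncomputable section

namespace Summit.Ventures.Crystal3D.Theorems

open Summit.Ventures.Crystal3D Finset
open Literature.MathematicalPhysics.StatisticalMechanics (fccStacking orderedContacts contactDeficiency)
open scoped InnerProductSpace

/-! ### The per-ball lemma -/

/-- **(T2) at a ball whose contacts lie on six lines.**  `P ⊆ X`, `q ∈ X \ P`; `Φ` an integer
potential whose order on the film partners of `q` is that of the real function `f`; substrate
partners have `f < f q`; `f` is midpoint-convex at `q`; and every partner of `q` in `X` is `q + w` or
`q − w` for some `w` in a set `W` of at most six vectors.  Then
`#below + #plug ≤ (12 − deg q) + #above` at `q`. -/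
theorem antipodal_noGainPotential (X P : Finset (EuclideanSpace ℝ (Fin 3))) (hPX : P ⊆ X)
    (q : EuclideanSpace ℝ (Fin 3)) (Φ : EuclideanSpace ℝ (Fin 3) → ℤ)
    (f : EuclideanSpace ℝ (Fin 3) → ℝ)
    (hlt : ∀ x ∈ X \ P, dist q x = 1 → (Φ x < Φ q ↔ f x < f q))
    (heq : ∀ x ∈ X \ P, dist q x = 1 → (Φ x = Φ q ↔ f x = f q))
    (hplug : ∀ p ∈ P, dist q p = 1 → f p < f q)
    (hconv : ∀ w : EuclideanSpace ℝ (Fin 3), 2 * f q ≤ f (q + w) + f (q - w))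
    (W : Finset (EuclideanSpace ℝ (Fin 3))) (hW : W.card ≤ 6)
    (hslot : ∀ x ∈ X, dist q x = 1 → ∃ w ∈ W, x = q + w ∨ x = q - w) :
    (((X \ P).filter fun x => dist q x = 1 ∧ Φ x < Φ q).card : ℤ)
        + ((P.filter fun p => dist q p = 1).card : ℤ)
      ≤ (12 - ((X.filter fun x => dist q x = 1).card : ℤ))
        + (((X \ P).filter fun x => dist q x = 1 ∧ Φ q < Φ x).card : ℤ) := by
  classical
  rw [noGainPotential_iff X P hPX Φ q]
  -- read the below / level partners through `f`
  have hbelow : ((X \ P).filter fun x => dist q x = 1 ∧ Φ x < Φ q) =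
      (X \ P).filter fun x => dist q x = 1 ∧ f x < f q := by
    refine filter_congr fun x hx => ?_
    constructor
    · rintro ⟨hd, h⟩; exact ⟨hd, (hlt x hx hd).1 h⟩
    · rintro ⟨hd, h⟩; exact ⟨hd, (hlt x hx hd).2 h⟩
  have hlevel : ((X \ P).filter fun x => dist q x = 1 ∧ Φ x = Φ q) =
      (X \ P).filter fun x => dist q x = 1 ∧ f x = f q := by
    refine filter_congr fun x hx => ?_
    constructor
    · rintro ⟨hd, h⟩; exact ⟨hd, (heq x hx hd).1 h⟩
    · rintro ⟨hd, h⟩; exact ⟨hd, (heq x hx hd).2 h⟩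
  rw [hbelow, hlevel]
  -- the weight-two set `A` (substrate partners and f-below film partners) and the level set `L`
  set A := (P.filter fun p => dist q p = 1) ∪ ((X \ P).filter fun x => dist q x = 1 ∧ f x < f q)
    with hA
  set L := (X \ P).filter fun x => dist q x = 1 ∧ f x = f q with hL
  have hPQ : Disjoint P (X \ P) := disjoint_sdiff
  have hAcard : A.card = (P.filter fun p => dist q p = 1).card +
      ((X \ P).filter fun x => dist q x = 1 ∧ f x < f q).card := by
    rw [hA, card_union_of_disjoint]
    exact disjoint_filter_filter hPQ
  have hAf : ∀ y ∈ A, (y ∈ X ∧ dist q y = 1) ∧ f y < f q := by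
    intro y hy
    rw [hA, mem_union, mem_filter, mem_filter] at hy
    rcases hy with ⟨hyP, hd⟩ | ⟨hyQ, hd, hf⟩
    · exact ⟨⟨hPX hyP, hd⟩, hplug y hyP hd⟩
    · exact ⟨⟨(mem_sdiff.1 hyQ).1, hd⟩, hf⟩
  have hLf : ∀ y ∈ L, (y ∈ X ∧ dist q y = 1) ∧ f y = f q := by
    intro y hy
    rw [hL, mem_filter] at hy
    exact ⟨⟨(mem_sdiff.1 hy.1).1, hy.2.1⟩, hy.2.2⟩
  -- the pair lemma: `q + w ∈ A` excludes `q − w ∈ A ∪ L`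
  have pair : ∀ w : EuclideanSpace ℝ (Fin 3), q + w ∈ A → q - w ∉ A ∧ q - w ∉ L := by
    intro w hw
    have h1 := (hAf _ hw).2
    have hc := hconv w
    constructor
    · intro h2; have := (hAf _ h2).2; linarith
    · intro h2; have := (hLf _ h2).2; linarith
  -- index sets on `W`
  set IA := W.filter fun w => q + w ∈ A with hIA
  set IA' := W.filter fun w => q - w ∈ A with hIA'
  set IL := W.filter fun w => q + w ∈ L with hIL
  set IL' := W.filter fun w => q - w ∈ L with hIL'
  -- every partner is `q + w` or `q − w`
  have cover : ∀ (S : Finset (EuclideanSpace ℝ (Fin 3))), (∀ y ∈ S, y ∈ X ∧ dist q y = 1) →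
      S.card ≤ (W.filter fun w => q + w ∈ S).card + (W.filter fun w => q - w ∈ S).card := by
    intro S hS
    have hsub : S ⊆ (W.filter fun w => q + w ∈ S).image (fun w => q + w) ∪
        (W.filter fun w => q - w ∈ S).image (fun w => q - w) := by
      intro y hy
      obtain ⟨w, hw, h⟩ := hslot y (hS y hy).1 (hS y hy).2
      rw [mem_union]
      rcases h with rfl | rfl
      · exact Or.inl (mem_image.2 ⟨w, mem_filter.2 ⟨hw, hy⟩, rfl⟩)
      · exact Or.inr (mem_image.2 ⟨w, mem_filter.2 ⟨hw, hy⟩, rfl⟩)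
    calc S.card ≤ ((W.filter fun w => q + w ∈ S).image (fun w => q + w) ∪
          (W.filter fun w => q - w ∈ S).image (fun w => q - w)).card := card_le_card hsub
      _ ≤ ((W.filter fun w => q + w ∈ S).image (fun w => q + w)).card +
          ((W.filter fun w => q - w ∈ S).image (fun w => q - w)).card := card_union_le _ _
      _ ≤ (W.filter fun w => q + w ∈ S).card + (W.filter fun w => q - w ∈ S).card :=
          add_le_add card_image_le card_image_le
  have hcardA : A.card ≤ IA.card + IA'.card := cover A fun y hy => (hAf y hy).1
  have hcardL : L.card ≤ IL.card + IL'.card := cover L fun y hy => (hLf y hy).1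
  -- disjointness
  have hd1 : Disjoint IA IA' := by
    rw [hIA, hIA']
    exact disjoint_filter.2 fun w _ h1 h2 => (pair w h1).1 h2
  have hd2 : Disjoint IA (IL ∪ IL') := by
    rw [hIA, hIL, hIL', ← filter_or]
    refine disjoint_filter.2 fun w _ h1 h2 => ?_
    rcases h2 with h2 | h2
    · have := (hAf _ h1).2; have := (hLf _ h2).2; linarith
    · exact (pair w h1).2 h2
  have hd3 : Disjoint IA' (IL ∪ IL') := by
    rw [hIA', hIL, hIL', ← filter_or]
    refine disjoint_filter.2 fun w _ h1 h2 => ?_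
    rcases h2 with h2 | h2
    · -- `q − w ∈ A`, `q + w ∈ L`: the pair lemma at `−w`
      have h := (pair (-w) (by rw [← sub_eq_add_neg]; exact h1)).2
      rw [sub_neg_eq_add] at h
      exact h h2
    · have := (hAf _ h1).2; have := (hLf _ h2).2; linarith
  have hunion : (IA ∪ IA' ∪ (IL ∪ IL')).card ≤ 6 := by
    refine le_trans (card_le_card ?_) hW
    rw [hIA, hIA', hIL, hIL']
    exact union_subset (union_subset (filter_subset _ _) (filter_subset _ _))
      (union_subset (filter_subset _ _) (filter_subset _ _))
  rw [card_union_of_disjoint (disjoint_union_left.2 ⟨hd2, hd3⟩), card_union_of_disjoint hd1]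
    at hunion
  have hLL : IL.card + IL'.card ≤ 2 * (IL ∪ IL').card := by
    have h1 : IL.card ≤ (IL ∪ IL').card := card_le_card subset_union_left
    have h2 : IL'.card ≤ (IL ∪ IL').card := card_le_card subset_union_right
    linarith
  zify at hAcard hcardA hcardL hunion hLL
  linarith

/-! ### The rung -/

/-- **The atom at every normal for films with antipodally supported shells** (`R = 1`, `C = 0`;
registered by name on stmt-Ventures-19144).  For every unit `ν`, every `ρ ≥ 1` and every finite
unit packing `X ⊇ P` around the `ν`-slab sample `P` of `Λ₀` such that
(i) every film ball `q` has at most six contacts in `X`, or all its contacts in `X` are of the form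
`q + w` / `q − w` for `w` in some set of at most six vectors; and
(ii) a film ball with a substrate partner does not lie in the slab sample region
`{−2R ≤ ⟪y,ν⟫ ≤ −R, ‖y‖² − ⟪y,ν⟫² ≤ ρ²}`:
`#cross(P, X \ P) ≤ contactDeficiency (X \ P)`. -/
theorem antipodalFilm_adhesion :
    ∃ R C : ℝ, 1 ≤ R ∧ ∀ ν : EuclideanSpace ℝ (Fin 3), ‖ν‖ = 1 → ∀ ρ : ℝ, R ≤ ρ →
      ∀ X P : Finset (EuclideanSpace ℝ (Fin 3)),
      (∀ p ∈ X, ∀ q ∈ X, p ≠ q → 1 ≤ dist p q) → P ⊆ X →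
      (∀ p, p ∈ P ↔ (p ∈ fccStacking 1 (Real.sqrt (2 / 3)) ∧ -(2 * R) ≤ ⟪p, ν⟫_ℝ ∧
        ⟪p, ν⟫_ℝ ≤ -R ∧ ‖p‖ ^ 2 - ⟪p, ν⟫_ℝ ^ 2 ≤ ρ ^ 2)) →
      (∀ q ∈ X \ P, (X.filter fun x => dist q x = 1).card ≤ 6 ∨
        ∃ W : Finset (EuclideanSpace ℝ (Fin 3)), W.card ≤ 6 ∧
          ∀ x ∈ X, dist q x = 1 → ∃ w ∈ W, x = q + w ∨ x = q - w) →
      (∀ q ∈ X \ P, ∀ p ∈ P, dist q p = 1 →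
        ¬(-(2 * R) ≤ ⟪q, ν⟫_ℝ ∧ ⟪q, ν⟫_ℝ ≤ -R ∧ ‖q‖ ^ 2 - ⟪q, ν⟫_ℝ ^ 2 ≤ ρ ^ 2)) →
      ((((P ×ˢ (X \ P)).filter fun pq => dist pq.1 pq.2 = 1).card : ℕ) : ℝ) ≤
        contactDeficiency (X \ P) + C * ρ := by
  classical
  refine ⟨1, 0, le_rfl, fun ν hν ρ hρ X P hX hPX hP hanti hout => ?_⟩
  -- the convex slab gauge and its rank on the film
  set f : EuclideanSpace ℝ (Fin 3) → ℝ := fun y =>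
    max (ρ ^ 2 * (2 * ⟪y, ν⟫_ℝ + 3 * 1) ^ 2) (1 ^ 2 * (‖y‖ ^ 2 - ⟪y, ν⟫_ℝ ^ 2)) with hf
  set Φ : EuclideanSpace ℝ (Fin 3) → ℤ := fun x => (((X \ P).filter fun y => f y < f x).card : ℤ)
    with hΦ
  have h := cross_le_of_potential X P ∅ hX hPX (empty_subset _) Φ fun q hq => by
    rw [sdiff_empty] at hq
    rcases hanti q hq with hdeg | ⟨W, hW, hslot⟩
    · -- at most six contacts: (T2) holds for any potential
      rw [noGainPotential_iff X P hPX Φ q]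
      have h1 := card_partners_eq_plug_add_film X P hPX q
      have h2 := card_film_partners_eq (X \ P) Φ q
      zify at h1 h2 hdeg
      have h3 : (0 : ℤ) ≤ (((X \ P).filter fun x => dist q x = 1 ∧ Φ q < Φ x).card : ℤ) :=
        Nat.cast_nonneg _
      linarith
    · refine antipodal_noGainPotential X P hPX q Φ f (fun x hx _ => ?_) (fun x hx _ => ?_)
        (fun p hp hd => ?_) (fun w => ?_) W hW hslot
      · simp only [hΦ]; exact rank_lt_iff (X \ P) f x q hx
      · simp only [hΦ]; exact rank_eq_iff (X \ P) f x q hx hq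
      · -- substrate partners are gauge-below: `f p ≤ ρ² < f q`
        obtain ⟨_, hp1, hp2, hp3⟩ := (hP p).1 hp
        have hle : f p ≤ 1 ^ 2 * ρ ^ 2 := by
          simp only [hf]; exact slabGauge_le ν 1 ρ p hp1 hp2 hp3
        have hlt : 1 ^ 2 * ρ ^ 2 < f q := by
          simp only [hf]
          exact lt_slabGauge ν 1 ρ one_pos (by linarith) q (hout q hq p hp hd)
        linarith
      · simp only [hf]; exact slabGauge_midpoint ν hν 1 ρ q w
  simpa using h

end Summit.Ventures.Crystal3D.Theorems

end
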